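import Mathlib.CategoryTheory.Groupoid
import Mathlib.CategoryTheory.Core
import Mathlib.CategoryTheory.Pi.Basic
import Mathlib.CategoryTheory.ObjectProperty.FullSubcategory
import Mathlib.CategoryTheory.Comma.Basic
import Mathlib.Logic.Equiv.Defs
import Mathlib.Data.Real.Basic
import Mathlib.Algebra.Order.Hom.Monoid
import Literature.IUT.LogThetaLattice.StripCategories
import HarnessLib

/-!
# [IUTchIII] Definition 2.4: `F^{⊢⊥}`-, `F^{⊢▶}`-, `F^{⊩⊥}`-, `F^{⊩▶}`-prime-strips (and Remarks 2.4.1, 2.4.2 (i), (v), (vi))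

Mochizuki, *Inter-universal Teichmüller Theory III*, kurims manuscript (May 2020), §2, Definition 2.4,
pp. 87–89, Remarks 2.4.1–2.4.2, pp. 89–91 (D-0012 claim key, status disputed; every decl below carries
`[claim: Mochizuki2012, status: disputed]`; this file is definitional and takes no side).

Printed text.
* Def 2.4 (i) pp.87–88: for an `F^⊢`-prime-strip `‡F^⊢ = {‡F^⊢_v}`, "at each `w ∈ V̲^{bad}`, the splittings of
  the split Frobenioid `‡F^⊢_w` determine submonoids "`O^⊥(−) ⊆ O^▷(−)`", as well as quotient monoids
  "`O^⊥(−) ↠ O^▶(−)`" [i.e., by forming the quotient of "`O^⊥(−)`" by its torsion subgroup]. … for each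
  `w ∈ V̲^{good}`, the splitting … determines a submonoid "`O^⊥(−) ⊆ O^▷(−)`" whose subgroup of units is
  trivial …; in this case, we set `O^▶(−) := O^⊥(−)`. Write `‡F^{⊢⊥} = {‡F^{⊢⊥}_v}`; `‡F^{⊢▶} = {‡F^{⊢▶}_v}` for
  the collections of data obtained by replacing the split Frobenioid portion of each `‡F^⊢_v` by the
  Frobenioids determined, respectively, by the subquotient monoids "`O^⊥(−) ⊆ O^▷(−)`", "`O^▶(−)`"."
* Def 2.4 (ii) p.88: `F^{⊢⊥}`- / `F^{⊢▶}`-prime-strips = collections `{*F_v}` with `*F_v` isomorphic to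
  `‡F^{⊢⊥}_v` / `‡F^{⊢▶}_v`; morphisms = `V̲`-indexed collections of isomorphisms (`StripCat`).
* Def 2.4 (iii) pp.88–89: "an `F^{⊩⊥}`-prime-strip [is] a collection of data
  `*F^{⊩⊥} = (*C^⊩, Prime(*C^⊩) ⥲ V̲, *F^{⊢⊥}, {*ρ_v}_{v∈V̲})` satisfying the conditions (a), (b), (c), (d),
  (e), (f) of [IUTchI], Definition 5.2, (iv), for an `F^⊩`-prime-strip, except that the portion …
  constituted by an `F^⊢`-prime-strip is replaced by an `F^{⊢⊥}`-prime-strip" [IUTchI p.135: (a) `*C^⊩` is a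
  category isomorphic to the model `C^⊩_{mod}`; (b) `Prime(−)`; (c) `Prime(*C^⊩) ⥲ V̲` a bijection; (d) the
  strip; (e) `*ρ_v : Φ_{*C^⊩,v} ⥲ Φ^{rlf}_{*C^⊢_v}` an isomorphism of topological monoids, both `≅ ℝ_{≥0}`; (f)
  the collection is isomorphic to the model `F^⊩_{mod}`]; similarly `F^{⊩▶}`; "A morphism … is defined to
  be an isomorphism between collections of data".
* Rmk 2.4.1 (i)(ii) p.89: multiradiality of Cor 2.3 (i) "implying a corresponding multiradiality
  assertion concerning the associated `F^{⊩⊥}`-prime-strips"; at `v ∈ V̲^{bad}` "the submonoids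
  "`O^⊥(−) ⊆ O^▷(−)`" may be regarded … as submonoids of the monoids "`_∞Ψ^⊥_{env}(†D_>)_v`"" compatibly.
* Rmk 2.4.2 (i) p.89: "one may associate to an `F^{⊩▶}`-prime-strip a pilot object in the global
  realified Frobenioid portion"; (v)–(vi) pp.90–91: from `M := Pic(*C^⊩)` (an ordered monoid `≅ ℝ` by
  [FrdI] Thm 6.4) and the negative pilot element the data of Rmk 2.4.2 (iii)/(iv) reconstruct
  `(*C^⊩, Prime(*C^⊩) ⥲ V̲)` resp. `(*C^⊩, Prime(*C^⊩) ⥲ V̲, {Φ_{*F^{⊢▶}_v}}_v, {*ρ_v}_v)`; distinct NEGATIVE pilot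
  elements "may be compared" in the common container `*C^⊩`, positive vs negative may not.

Typing. Def 2.4 (i) = the monoid-level operations `O^⊥ ⊆ O^▷`, `O^▶ = O^⊥/O^μ` (`ModTorsion` of
`StripCategories.lean`) plus the INTERFACE `PerpLocalData` for "the Frobenioid determined by a monoid"
at each `v` (owners: abc-iut-L1 [FrdI] §5 model Frobenioids, abc-iut-L5-t2/t4 [IUTchI] Def 5.2; TODO-merge);
Def 2.4 (ii) = `FperpStrip`, `FtriStrip` := `StripCat` on that data, with the functorial passage from
`F^⊢`-prime-strips; Def 2.4 (iii) = the GENERIC "globally realified quadruple" category `GlQuadruple Q` = Mathlib's COMMA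
category of the two functors `Φ` (divisor monoids of `V̲`-labelled global realified Frobenioids) and `Φ^{rlf}`
(realified monoids of strips) of the interface `GlobalRealifiedFrame Q` ([IUTchI] Ex 3.5 / Def 5.2 (iv)
(a)(b)(c)(e) — owners L5-t2/t4, L1-t3): objects `(*C^⊩ with Prime ⥲ V̲, *F, ρ)`, morphisms = pairs of
isomorphisms compatible with the labels AND the `ρ_v` (review of p404582); the prime-strips = the
connected component of the model (`GlStripCat`, (f)): at `Str := FperpStrip` / `FtriStrip` this is `F^{⊩⊥}` /
`F^{⊩▶}`, and at `F^⊢`-strips it is [IUTchI]'s `F^⊩` (for abc-iut-L5-t4 to reuse). Rmk 2.4.2 (ii)–(iv): `PilotWeights.lean`. Deliberately NOT typed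
(expository / need [FrdI] Pic): Rmk 2.4.1 (i), (ii); Rmk 2.4.2 (i), (v), (vi) beyond the ordered-monoid
shape `PicData` below.
-/

namespace Literature.IUT.LogThetaLattice

open CategoryTheory

universe u w

/-! ### Def 2.4 (i): the local data `O^⊥ ⊆ O^▷`, `O^▶`, and the Frobenioids they determine -/

/-- **IUTchIII:Def2.4(i)** (kurims pp.87–88) The monoid-level content of Def 2.4 (i) at one place: the
monoid `O^▷(−)` of the (split) Frobenioid, the submonoid `O^⊥(−) ⊆ O^▷(−)` "determined by the splittings"
(and, at bad places, the `2l`-torsion), whence `O^▶(−) := O^⊥(−)/O^μ` (`ModTorsion`; at good places the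
quotient map is bijective, `ModTorsion.mk_bijective_of_torsionfree`). [claim: Mochizuki2012, status: disputed] -/
structure PerpMonoidData where
  /-- `O^▷(−)`, the monoid of the split Frobenioid at `v` -/
  O : Type u
  [commMonoid : CommMonoid O]
  /-- `O^⊥(−) ⊆ O^▷(−)`, the submonoid determined by the splitting [IUTchII, Def 4.9 (ii)(iv)] -/
  perp : Submonoid O

attribute [instance] PerpMonoidData.commMonoid

namespace PerpMonoidData

/-- **IUTchIII:Def2.4(i)** (kurims p.88) `O^▶(−) := O^⊥(−) / (torsion)`. [claim: Mochizuki2012, status: disputed] -/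
abbrev tri (P : PerpMonoidData.{u}) : Type u := ModTorsion P.perp

/-- **IUTchIII:Def2.4(i)** (kurims p.88) the quotient map `O^⊥(−) ↠ O^▶(−)`. [claim: Mochizuki2012, status: disputed] -/
def toTri (P : PerpMonoidData.{u}) : P.perp →* P.tri := ModTorsion.mk P.perp

/-- **IUTchIII:Def2.4(i)** (kurims p.88) good places: "whose subgroup of units is trivial … in this case, we
set `O^▶(−) := O^⊥(−)`" — the quotient map is then a bijection. [claim: Mochizuki2012, status: disputed] -/
theorem toTri_bijective_of_units_trivial (P : PerpMonoidData.{u}) [Subsingleton (P.perp)ˣ] :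
    Function.Bijective P.toTri :=
  ModTorsion.mk_bijective_of_units_trivial _

end PerpMonoidData

/-- **STUB for IUTchI:Def5.2(ii) / FrdI:Thm5.2** TODO-merge:abc-iut-L5-t4 / abc-iut-L1 — (kurims p.88) the
local categories Def 2.4 (i)–(ii) range over, at each `v ∈ V̲`: the ambient category `Fv v` of the data
`‡F^⊢_v` (split Frobenioid [+ object of `TM^⊢` at archimedean `v`]), the ambient categories `Fperp v`,
`Ftri v` of the data `‡F^{⊢⊥}_v`, `‡F^{⊢▶}_v`, the model objects, and the functorial passage "replacing the
split Frobenioid portion … by the Frobenioids determined, respectively, by the subquotient monoids"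
("the Frobenioid determined by a monoid" = [FrdI] Thm 5.2 model Frobenioids). [claim: Mochizuki2012, status: disputed] -/
structure PerpLocalData (V : Type w) where
  /-- ambient category of the local data `*F^⊢_v` [IUTchI, Def 5.2 (ii)] -/
  Fv : V → Type u
  [catFv : ∀ v, Category.{u} (Fv v)]
  /-- ambient category of the local data `*F^{⊢⊥}_v` [Def 2.4 (i)] -/
  Fperp : V → Type u
  [catFperp : ∀ v, Category.{u} (Fperp v)]
  /-- ambient category of the local data `*F^{⊢▶}_v` [Def 2.4 (i)] -/
  Ftri : V → Type u
  [catFtri : ∀ v, Category.{u} (Ftri v)]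
  /-- the model `F^⊢_v` [IUTchI, Ex 3.2 (v), 3.3 (i), 3.4 (ii)] -/
  modelFv : ∀ v, Fv v
  /-- `‡F^⊢_v ↦ ‡F^{⊢⊥}_v` (replace `O^▷` by `O^⊥ ⊆ O^▷`) [Def 2.4 (i)] -/
  toPerp : ∀ v, Fv v ⥤ Fperp v
  /-- `‡F^⊢_v ↦ ‡F^{⊢▶}_v` (replace `O^▷` by `O^▶`) [Def 2.4 (i)] -/
  toTri : ∀ v, Fv v ⥤ Ftri v
  /-- the monoid data `O^⊥(−) ⊆ O^▷(−)` underlying `*F^⊢_v` (nonarchimedean `v`) [Def 2.4 (i)]; recorded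
  only — this STUB does not tie `toPerp`/`toTri` to "the Frobenioid determined by" these monoids
  ([FrdI] Thm 5.2, owner abc-iut-L1) -/
  monoids : ∀ v, Fv v → PerpMonoidData.{u}

attribute [instance] PerpLocalData.catFv PerpLocalData.catFperp PerpLocalData.catFtri

namespace PerpLocalData

variable {V : Type w} (P : PerpLocalData.{u, w} V)

/-- **IUTchIII:Def2.4(i)** (kurims p.88) the model `‡F^{⊢⊥}_v := ` image of the model `F^⊢_v`. [claim: Mochizuki2012, status: disputed] -/
def modelPerp (v : V) : P.Fperp v := (P.toPerp v).obj (P.modelFv v)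

/-- **IUTchIII:Def2.4(i)** (kurims p.88) the model `‡F^{⊢▶}_v`. [claim: Mochizuki2012, status: disputed] -/
def modelTri (v : V) : P.Ftri v := (P.toTri v).obj (P.modelFv v)

/-! ### Def 2.4 (ii): the prime-strip categories -/

/-- **IUTchI:Def5.2(ii)** (kurims p.134 of [IUTchI]) the category of `F^⊢`-prime-strips over this local data
(for comparison; owner abc-iut-L5-t4). [claim: Mochizuki2012, status: disputed] -/
abbrev FvStrip : Type (max u w) := StripCat P.Fv P.modelFv

/-- **IUTchIII:Def2.4(ii)** (kurims p.88) **the category of `F^{⊢⊥}`-prime-strips**: collections `{*F^{⊢⊥}_v}_{v∈V̲}`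
with `*F^{⊢⊥}_v ≅ ‡F^{⊢⊥}_v`, morphisms = `V̲`-indexed collections of isomorphisms. [claim: Mochizuki2012, status: disputed] -/
abbrev FperpStrip : Type (max u w) := StripCat P.Fperp P.modelPerp

/-- **IUTchIII:Def2.4(ii)** (kurims p.88) **the category of `F^{⊢▶}`-prime-strips**. [claim: Mochizuki2012, status: disputed] -/
abbrev FtriStrip : Type (max u w) := StripCat P.Ftri P.modelTri

/-- **IUTchIII:Def2.4(ii)** (kurims p.88) any two `F^{⊢⊥}`-prime-strips are isomorphic. [claim: Mochizuki2012, status: disputed] -/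
theorem FperpStrip.iso_nonempty (X Y : P.FperpStrip) : Nonempty (X ≅ Y) := StripCat.iso_nonempty X Y

/-- **IUTchIII:Def2.4(ii)** (kurims p.88) any two `F^{⊢▶}`-prime-strips are isomorphic. [claim: Mochizuki2012, status: disputed] -/
theorem FtriStrip.iso_nonempty (X Y : P.FtriStrip) : Nonempty (X ≅ Y) := StripCat.iso_nonempty X Y

/-- **IUTchIII:Def2.4(i)** (kurims p.88) `‡F^⊢ ↦ ‡F^{⊢⊥}` on objects: apply `toPerp` componentwise (each
component stays isomorphic to the model since functors preserve isomorphisms). [claim: Mochizuki2012, status: disputed] -/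
def perpOfFv (X : P.FvStrip) : P.FperpStrip :=
  StripCat.mk' (fun v => (P.toPerp v).obj (X.val v)) fun v => ⟨(P.toPerp v).mapIso (X.isStrip v).some⟩

/-- **IUTchIII:Def2.4(i)** (kurims p.88) `‡F^⊢ ↦ ‡F^{⊢▶}` on objects. [claim: Mochizuki2012, status: disputed] -/
def triOfFv (X : P.FvStrip) : P.FtriStrip :=
  StripCat.mk' (fun v => (P.toTri v).obj (X.val v)) fun v => ⟨(P.toTri v).mapIso (X.isStrip v).some⟩

/-- **IUTchIII:Def2.4(i)** (kurims p.88) `‡F^⊢ ↦ ‡F^{⊢⊥}` on morphisms (componentwise). [claim: Mochizuki2012, status: disputed] -/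
def perpOfFvMap {X Y : P.FvStrip} (f : X ⟶ Y) : P.perpOfFv X ⟶ P.perpOfFv Y :=
  StripCat.ofComponents fun v => (P.toPerp v).mapIso (StripCat.component f v)

/-- **IUTchIII:Def2.4(i)** (kurims p.88) `‡F^⊢ ↦ ‡F^{⊢▶}` on morphisms (componentwise). [claim: Mochizuki2012, status: disputed] -/
def triOfFvMap {X Y : P.FvStrip} (f : X ⟶ Y) : P.triOfFv X ⟶ P.triOfFv Y :=
  StripCat.ofComponents fun v => (P.toTri v).mapIso (StripCat.component f v)

end PerpLocalData

/-! ### Def 2.4 (iii): globally realified prime-strips `F^{⊩⊥}`, `F^{⊩▶}` (generic quadruples) -/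

/-- **STUB for IUTchI:Def5.2(iv) / IUTchI:Ex3.5** TODO-merge:abc-iut-L5-t4 / L5-t2 / L1-t3 — (kurims [IUTchI]
p.135) the frame for conditions (a), (b), (c), (e) of a globally realified quadruple, for strips `*F : Str`
of any kind: `GR` = the groupoid of `V̲`-LABELLED global realified Frobenioids — pairs
(`*C^⊩` "isomorphic to the model `C^⊩_{mod}`", bijection `Prime(*C^⊩) ⥲ V̲`) with the LABEL-PRESERVING
isomorphisms of Frobenioids as morphisms (this packages (a), (b), (c) and makes "compatible with the
bijections `Prime(−) ⥲ V̲`" part of the morphisms); `TM` = topological monoids `≅ ℝ_{≥0}` with their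
isomorphisms; the divisor monoids `Φ_{*C^⊩, v}` ([IUTchI] Ex 3.5 (i)) and the realified monoids
`Φ^{rlf}_{*F_v}` of the `v`-component of a strip (Def 5.2 (iv) (e)) as FUNCTORS to `V̲`-indexed families, so
that both are functorial in isomorphisms by construction. [claim: Mochizuki2012, status: disputed] -/
structure GlobalRealifiedFrame (V : Type w) (Str : Type (max u w)) [Category.{max u w} Str] where
  /-- `V̲`-labelled global realified Frobenioids `(*C^⊩, Prime(*C^⊩) ⥲ V̲)`, label-preserving isomorphisms
  [IUTchI, Def 5.2 (iv) (a)(b)(c)] -/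
  GR : Type u
  [catGR : Groupoid.{u} GR]
  /-- topological monoids `≅ ℝ_{≥0}` with isomorphisms [IUTchI, Def 5.2 (iv) (e)] -/
  TM : Type u
  [catTM : Groupoid.{u} TM]
  /-- `*C^⊩ ↦ (v ↦ Φ_{*C^⊩, v})`, the divisor monoid at the prime labelled `v` [IUTchI, Ex 3.5 (i)], functorially -/
  Φ : GR ⥤ (V → TM)
  /-- `*F ↦ (v ↦ Φ^{rlf}_{*F_v})`, the realified monoid of the `v`-component [IUTchI, Def 5.2 (iv) (e)], functorially -/
  Φrlf : Str ⥤ (V → TM)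

attribute [instance] GlobalRealifiedFrame.catGR GlobalRealifiedFrame.catTM

/-- **IUTchIII:Def2.4(iii)** (kurims pp.88–89) a quadruple `(*C^⊩, Prime(*C^⊩) ⥲ V̲, *F, {*ρ_v}_{v∈V̲})` with (e)
"`*ρ_v : Φ_{*C^⊩,v} ⥲ Φ^{rlf}_{*C^⊢_v}` … an isomorphism of topological monoids" for every `v`, and its morphisms:
"an isomorphism between collections of data" = a label-preserving isomorphism `c : *C^⊩ ⥲ *C'^⊩` and an
isomorphism of strips `s : *F ⥲ *F'` COMPATIBLE with the `ρ`'s (`Φ(c)_v ≫ *ρ'_v = *ρ_v ≫ Φ^{rlf}(s)_v`). This is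
precisely Mathlib's comma category of `Φ` and `Φ^{rlf}` (objects `(C, F, ρ : Φ C → Φ^{rlf} F)`, morphisms =
commuting squares); all `ρ` and all morphisms are isomorphisms since `GR`, `TM` (hence `V̲ → TM`) and the
strip categories are groupoids. Works for strips of any kind (`F^⊢`: [IUTchI] `F^⊩`; `F^{⊢⊥}`: `F^{⊩⊥}`;
`F^{⊢▶}`: `F^{⊩▶}`). [claim: Mochizuki2012, status: disputed] -/
abbrev GlQuadruple {V : Type w} {Str : Type (max u w)} [Category.{max u w} Str]
    (Q : GlobalRealifiedFrame.{u, w} V Str) : Type (max u w) :=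
  Comma Q.Φ Q.Φrlf

namespace GlQuadruple

variable {V : Type w} {Str : Type (max u w)} [Category.{max u w} Str] {Q : GlobalRealifiedFrame.{u, w} V Str}

/-- **IUTchIII:Def2.4(iii)** (kurims p.88) (a)+(c): the labelled Frobenioid `(*C^⊩, Prime(*C^⊩) ⥲ V̲)`.
[claim: Mochizuki2012, status: disputed] -/
abbrev frob (X : GlQuadruple Q) : Q.GR := X.left

/-- **IUTchIII:Def2.4(iii)** (kurims p.88) (d): the strip `*F`. [claim: Mochizuki2012, status: disputed] -/
abbrev strip (X : GlQuadruple Q) : Str := X.right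

/-- **IUTchIII:Def2.4(iii)** (kurims p.89) (e): `*ρ_v : Φ_{*C^⊩, v} → Φ^{rlf}_{*F_v}` at the label `v`.
[claim: Mochizuki2012, status: disputed] -/
abbrev ρ (X : GlQuadruple Q) (v : V) : Q.Φ.obj X.left v ⟶ Q.Φrlf.obj X.right v := X.hom v

/-- **IUTchIII:Def2.4(iii)** (kurims p.89) (e) "is an isomorphism of topological monoids": automatic, `TM`
being a groupoid. [claim: Mochizuki2012, status: disputed] -/
instance isIso_ρ (X : GlQuadruple Q) (v : V) : IsIso (X.ρ v) := inferInstance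

/-- **IUTchIII:Def2.4(iii)** (kurims p.89) morphisms are compatible with the `ρ`'s, componentwise:
`Φ(c)_v ≫ *ρ'_v = *ρ_v ≫ Φ^{rlf}(s)_v`. [claim: Mochizuki2012, status: disputed] -/
theorem hom_ρ_comm {X Y : GlQuadruple Q} (f : X ⟶ Y) (v : V) :
    Q.Φ.map f.left v ≫ Y.ρ v = X.ρ v ≫ Q.Φrlf.map f.right v :=
  congrFun f.w v

/-- **IUTchIII:Def2.4(iii)** (kurims p.89) build a morphism of quadruples from a label-preserving isomorphism
of Frobenioids and an isomorphism of strips compatible with the `ρ`'s. [claim: Mochizuki2012, status: disputed] -/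
def homMk {X Y : GlQuadruple Q} (c : X.left ⟶ Y.left) (s : X.right ⟶ Y.right)
    (h : ∀ v, Q.Φ.map c v ≫ Y.ρ v = X.ρ v ≫ Q.Φrlf.map s v) : X ⟶ Y :=
  { left := c, right := s, w := funext h }

end GlQuadruple

/-- **IUTchIII:Def2.4(iii)** (kurims p.89) condition (f): "isomorphic to the [model]" as an object
property of quadruples. [claim: Mochizuki2012, status: disputed] -/
def IsModelLike {V : Type w} {Str : Type (max u w)} [Category.{max u w} Str]
    {Q : GlobalRealifiedFrame.{u, w} V Str} (model : GlQuadruple Q) : ObjectProperty (GlQuadruple Q) :=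
  fun X => Nonempty (X ≅ model)

/-- **IUTchIII:Def2.4(iii)** (kurims pp.88–89) (f) "the collection of data … is isomorphic to the [model]":
the `F^{⊩□}`-prime-strips are the quadruples in the connected component of a chosen model quadruple
(core of the full subcategory; morphisms = isomorphisms of quadruples). [claim: Mochizuki2012, status: disputed] -/
def GlStripCat {V : Type w} {Str : Type (max u w)} [Category.{max u w} Str]
    (Q : GlobalRealifiedFrame.{u, w} V Str) (model : GlQuadruple Q) : Type (max u w) :=
  Core (IsModelLike model).FullSubcategory

/-- **IUTchIII:Def2.4(iii)** (kurims p.89) `GlStripCat` is a groupoid. [claim: Mochizuki2012, status: disputed] -/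
noncomputable instance {V : Type w} {Str : Type (max u w)} [Category.{max u w} Str]
    (Q : GlobalRealifiedFrame.{u, w} V Str) (model : GlQuadruple Q) : Groupoid (GlStripCat Q model) :=
  inferInstanceAs (Groupoid (Core _))

/-- **IUTchIII:Def2.4(iii)** (kurims p.89) any two `F^{⊩□}`-prime-strips are isomorphic (both isomorphic to
the model). [claim: Mochizuki2012, status: disputed] -/
theorem GlStripCat.iso_nonempty {V : Type w} {Str : Type (max u w)} [Category.{max u w} Str]
    {Q : GlobalRealifiedFrame.{u, w} V Str} {model : GlQuadruple Q} (X Y : GlStripCat Q model) :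
    Nonempty (X ≅ Y) :=
  ⟨(Groupoid.isoEquivHom X Y).symm
    (CoreHom.mk (ObjectProperty.isoMk _ (X.of.property.some ≪≫ Y.of.property.some.symm)))⟩

/-- **IUTchIII:Def2.4(iii)** (kurims pp.88–89) **`F^{⊩⊥}`-prime-strips**: quadruples over `F^{⊢⊥}`-prime-strips.
[claim: Mochizuki2012, status: disputed] -/
abbrev FglPerpStrip {V : Type w} (P : PerpLocalData.{u, w} V)
    (Q : GlobalRealifiedFrame.{u, w} V P.FperpStrip) (model : GlQuadruple Q) : Type (max u w) :=
  GlStripCat Q model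

/-- **IUTchIII:Def2.4(iii)** (kurims pp.88–89) **`F^{⊩▶}`-prime-strips**: quadruples over `F^{⊢▶}`-prime-strips.
[claim: Mochizuki2012, status: disputed] -/
abbrev FglTriStrip {V : Type w} (P : PerpLocalData.{u, w} V)
    (Q : GlobalRealifiedFrame.{u, w} V P.FtriStrip) (model : GlQuadruple Q) : Type (max u w) :=
  GlStripCat Q model

/-! ### Rmk 2.4.2 (v): the shape of `Pic(*C^⊩)` with its pilot element -/

/-- **IUTchIII:Rmk2.4.2(v)** (kurims p.90) the ordered-monoid data Rmk 2.4.2 (v) reads off an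
`F^{⊩▶}`-prime-strip: `M := Pic(*C^⊩)`, "equipped with a canonical structure of ordered monoid, with respect
to which it is isomorphic to `ℝ`" ([FrdI] Thm 6.4 (i)(ii)), and the pilot object's class, "a negative
element `η_{*C^⊩} ∈ Pic(*C^⊩)`". (The reconstruction statements (v), (vi) need [FrdI] Thm 5.1/6.4 —
owner abc-iut-L1-t3 — and are not typed here.) [claim: Mochizuki2012, status: disputed] -/
structure PicData where
  /-- `M = Pic(*C^⊩)` -/
  M : Type u
  [inst : AddCommMonoid M]
  [ord : PartialOrder M]
  /-- "isomorphic [as an ordered monoid] to `ℝ`" -/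
  isoReal : M ≃+o ℝ
  /-- the pilot element `η_{*C^⊩}` -/
  η : M
  /-- "a negative element" -/
  η_neg : isoReal η < 0

end Literature.IUT.LogThetaLattice
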